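import Summits.BirchSwinnertonDyer.BirchSwinnertonDyer.Theorems.ManinLocalTwoThreeManinPrimeToAdditiveFiveLeRedOrdinaryStarredTwin
import HarnessLib

/-!
# Route `ManinLocalTwoThree`, residual crux C5 `ManinPrimeToAdditiveFiveLe`
# (stmt-BirchSwinnertonDyer-22969), line `upper_anchor` (skeleton v9, registered stubs `stub_red7ordIV`,
# `stub_red57corner`): **the two potentially-ORDINARY unstarred cells ride their COMMUTING STARRED twins,
# granted E-imc-9 — `stub_red7ordIV` ⟸ ANCHOR(7; II*) ∧ E-imc-9(7), `stub_red57corner` ⟸ ANCHOR(5; III*) ∧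
# ANCHOR(7; IV*) ∧ E-imc-9(5) ∧ E-imc-9(7)**

Width seat bsd-line-ml23-c5-p1-w3 (gen 0), piece φ (part 2/2: the cells; part 1/2 =
`…RedOrdinaryStarredTwin.lean`, p628074: the twin packet at every `p ≥ 5` with potential ordinarity
DISCHARGED from `e ∣ p − 1`). Skeleton v9 (`Cruxes/ManinPrimeToAdditiveFiveLe/Lines/upper_anchor.lean`, lead
gen 5; kernel cell table `…RedFiveSevenCells.lean` p625709 / `…RedFiveSevenCellsTwin.lean` p626637):

| cell | `(p; ord_p Δ_min)` | `e` | pot. | starred twin | in range | this file |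
|---|---|---|---|---|---|---|
| ORD7 = `stub_red7ordIV` | (7; 4) | 3 | ord | (7; II*), `e = 6 = p − 1` | 43 commuting orbits, degree up | §2: ⟸ ANCHOR(7; II*) ∧ E-imc-9(7) |
| CORNER57, `p = 5` half | (5; 3) | 4 | ord | (5; III*), `e = 4 = p − 1` | 377 commuting | §3: ⟸ ANCHOR(5; III*) ∧ E-imc-9(5) |
| CORNER57, `p = 7` half | (7; 2) | 6 | ord | (7; IV*), `e = 3 < p − 1` | 112 commuting | §3: ⟸ ANCHOR(7; IV*) ∧ E-imc-9(7) (= ν p624458 ∘ -w4's ο) |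

ANCHOR(p; T*) := Manin's `p ∤ c(D)` for a lattice-optimal globally minimal `W` of that STARRED Kodaira cell under
the RED(57♯) cuts (`p² ∣ N > 5·10⁵`, globally twist-minimal, `W[p]` reducible, `p ∣ deg φ`, no `Iₙ*` fibre) —
the shape of the lead's ANCHOR(7; IV*) (hypothesis `hS` of ν, VERBATIM here). E-imc-9 =
`Summit.BirchSwinnertonDyer.Rank1Residual.ManinAdditive.OrdinaryRamifiedTwistLaw p`, the imc cell's registered,
refuter-vetted `@[conjecture]` (REF1 SURVIVES 2026-08-27; not in print).

* §1 `not_dvd_maninConstant_of_starredTwinAnchor_of_ordinaryRamifiedTwistLaw` — the CELL ENGINE (any `p ≥ 5`):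
  an anchor on the starred twin cell + E-imc-9(p) ⟹ `p ∤ c(D)` on the unstarred potentially-ordinary cell
  (twin packet: `v_p c(D₀) = v_p c(D)`; cuts transferred).
* §2 `red7ordIV_of_anchorIIstarSeven_of_ordinaryRamifiedTwistLaw` — **`stub_red7ordIV` VERBATIM ⟸ ANCHOR(7; II*)
  ∧ E-imc-9(7).** With θ (p617914/p617000: starred ⟸ unstarred by transport) the cells (7; IV) and (7; II*) are
  ONE problem modulo E-imc-9(7): Edixhoven's case 1 at `(7; IV)` IS the starred Kummer corner `(7; II*)`.
* §3 `red57corner_of_starredAnchors_of_ordinaryRamifiedTwistLaws` — **`stub_red57corner` VERBATIM ⟸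
  ANCHOR(5; III*) ∧ ANCHOR(7; IV*) ∧ E-imc-9(5) ∧ E-imc-9(7).**
* §4 `red57unstarredOffIIAtFive_of_ss_of_starredOrdAnchor_of_ordinaryRamifiedTwistLaws` — by-name ledger:
  **the v8 anchor stub ⟸ SS57 (`stub_red57ss`) ∧ ANCHOR-ORD★(57) ∧ E-imc-9(5) ∧ E-imc-9(7)**, ANCHOR-ORD★(57)
  being ONE hypothesis: Manin under the RED(57♯) cuts on the three starred potentially-ordinary cells
  `(p; ord_p Δ_min) ∈ {(5;9), (7;8), (7;10)}` (lead's p625709 ∘ §2 ∘ §3).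

NET READING (with -w2's υ/υ2 p626338/p626766 and -w4's ο): modulo the imc cell's registered laws E-imc-5(5, 7)
and E-imc-9(5, 7, 13), the `W[p]`-reducible residue of C5 at `p ∈ {5, 7}` is SS57 (potentially supersingular
unstarred cells `(5; IV)`, `(7; III)`, which FLIP — Edixhoven's Props 5–8 mechanism at `e < p − 1`) plus ONE Manin
statement per potentially-ORDINARY commuting orbit, readable on EITHER end; plus KP57 (stmt-23810) and the
cite-only printed inputs. HONEST STATUS: conditional results (`--supports`, helper) between OPEN statements;
nothing here proves any stub, C5, E-imc-9, Manin's conjecture or BSD. No summit statement is proved by this seat.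

References: [EdixhovenManin1991] Thm. 3, Prop. 7, §4; [KostersPannekoek2017] Thm. 1; [SerreTate1968] §2
Cor. 3; [ZagierCMB1985] §1; [SilvermanATAEC1994] IV Table 4.1; cell bsd-f2-manin MEMO-imc.md §10 (E-imc-9),
`Cruxes/ManinPrimeToAdditiveFiveLe/LEDGER-upper-anchor.md` (gens 4–5 cell tables).
-/

set_option autoImplicit false
-- the Theorems namespace of this sub repeats the summit name by design (D-0017 nested layout)
set_option linter.dupNamespace false

noncomputable section

open scoped Classical NumberField

namespace Summit.BirchSwinnertonDyer.BirchSwinnertonDyer.Theorems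

open WeierstrassCurve IsDedekindDomain IsDedekindDomain.HeightOneSpectrum Rat.HeightOneSpectrum NumberField
  Literature.NumberTheory.EllipticCurves Literature.NumberTheory.EllipticCurves.ModularForms
  Literature.NumberTheory.EllipticCurves.Rank1Residual
  Literature.NumberTheory.DiophantineGeometry
  Summit.BirchSwinnertonDyer.Rank1Residual.ManinAdditive
  Summit.BirchSwinnertonDyer.Rank1Residual.Additive

/-! ## §1 The cell engine: an unstarred potentially-ordinary cell rides an ANCHOR on its starred twin -/

/-- **CELL ENGINE.** At `p ≥ 5`, granted modularity and E-imc-9 `OrdinaryRamifiedTwistLaw p`: if Manin's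
`p ∤ c(D₀)` is known for every lattice-optimal globally minimal `W₀` carrying the RED(57♯) cuts (`p² ∣ N(W₀)`,
odd and dyadic twist-minimality, `W₀[p]` reducible, `N(W₀) > 5·10⁵`, `p ∣ deg(D₀)`, no `Iₙ*` fibre at `p`) with
`ord_p Δ_min(W₀) = ord_p Δ_min(W) + 6` (the ANCHOR on the starred twin cell), then `p ∤ c(D)` for the unstarred
`W` with the same cuts, `ord_p Δ_min(W) ≤ 4` and tame index `e ∣ p − 1`: the twin packet of part 1
(`exists_commuting_starred_twin_of_ordinaryRamifiedTwistLaw`) has `v_p c(D₀) = v_p c(D)` and inherits the cuts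
(`redCuts_of_commuting_starred_twin`). Conditional result; closes nothing.
[cite: EdixhovenManin1991, Thm. 3 and §4] [cite: ZagierCMB1985, §1] -/
theorem not_dvd_maninConstant_of_starredTwinAnchor_of_ordinaryRamifiedTwistLaw (hnf : exists_isNewformOf)
    {p : ℕ} (hp : p.Prime) (h5 : 5 ≤ p) (hO : OrdinaryRamifiedTwistLaw p)
    (W : WeierstrassCurve ℚ) [W.IsElliptic] [W.IsGloballyMinimal] [NeZero (W.conductorNorm ℤ)]
    (D : ModularParametrizationData W (W.conductorNorm ℤ)) (hD : IsLatticeOptimal D)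
    (hpN : p ^ 2 ∣ W.conductorNorm ℤ)
    (hodd : ¬ (∃ (W' : WeierstrassCurve ℚ) (q : ℕ), W'.IsElliptic ∧ W'.IsGloballyMinimal ∧ q.Prime ∧
        q ≠ 2 ∧ q ^ 2 ∣ W.conductorNorm ℤ ∧
        IsIsogenous W (W'.quadraticTwist (((-1 : ℤ) ^ (q / 2) * q : ℤ) : ℚ)) ∧
        ¬ q ^ 2 ∣ W'.conductorNorm ℤ))
    (hdy : ¬ (∃ (W' : WeierstrassCurve ℚ) (d : ℤ), W'.IsElliptic ∧ W'.IsGloballyMinimal ∧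
        (d = -1 ∨ d = 2 ∨ d = -2) ∧ 2 ^ 2 ∣ W.conductorNorm ℤ ∧
        IsIsogenous W (W'.quadraticTwist (d : ℚ)) ∧ ¬ 2 ^ 2 ∣ W'.conductorNorm ℤ))
    (hred : ¬ W.HasIrreducibleModPGaloisRep p) (hN : 500000 < W.conductorNorm ℤ)
    (hv4 : padicValInt p W.minimalDiscriminantInt ≤ 4)
    (he : 12 / Nat.gcd 12 (padicValInt p W.minimalDiscriminantInt) ∣ p - 1)
    (hanchor : ∀ (W₀ : WeierstrassCurve ℚ) [W₀.IsElliptic] [W₀.IsGloballyMinimal] [NeZero (W₀.conductorNorm ℤ)]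
      (D₀ : ModularParametrizationData W₀ (W₀.conductorNorm ℤ)),
      IsLatticeOptimal D₀ → p ^ 2 ∣ W₀.conductorNorm ℤ →
      ¬ (∃ (W' : WeierstrassCurve ℚ) (q : ℕ), W'.IsElliptic ∧ W'.IsGloballyMinimal ∧ q.Prime ∧
          q ≠ 2 ∧ q ^ 2 ∣ W₀.conductorNorm ℤ ∧
          IsIsogenous W₀ (W'.quadraticTwist (((-1 : ℤ) ^ (q / 2) * q : ℤ) : ℚ)) ∧
          ¬ q ^ 2 ∣ W'.conductorNorm ℤ) →
      ¬ (∃ (W' : WeierstrassCurve ℚ) (d : ℤ), W'.IsElliptic ∧ W'.IsGloballyMinimal ∧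
          (d = -1 ∨ d = 2 ∨ d = -2) ∧ 2 ^ 2 ∣ W₀.conductorNorm ℤ ∧
          IsIsogenous W₀ (W'.quadraticTwist (d : ℚ)) ∧ ¬ 2 ^ 2 ∣ W'.conductorNorm ℤ) →
      ¬ W₀.HasIrreducibleModPGaloisRep p → 500000 < W₀.conductorNorm ℤ → p ∣ D₀.modularDegree →
      (∀ n : ℕ, W₀.kodairaSymbolAt ((Rat.HeightOneSpectrum.primesEquiv (R := ℤ)).symm ⟨p, hp⟩) ≠ .Istar n) →
      padicValInt p W₀.minimalDiscriminantInt = padicValInt p W.minimalDiscriminantInt + 6 →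
      ¬ (p : ℤ) ∣ D₀.maninConstant) :
    ¬ (p : ℤ) ∣ D.maninConstant := by
  haveI hpF : Fact p.Prime := ⟨hp⟩
  obtain ⟨W₀, hE₀, hM₀, hne₀, u, D₀, hD₀, hu, -, htw, hNN, hpN₀, hup, hc, hΔ⟩ :=
    exists_commuting_starred_twin_of_ordinaryRamifiedTwistLaw hnf hp h5 hO W D hD hpN hodd hv4 he
  haveI := hE₀
  haveI := hM₀
  haveI := hne₀
  obtain ⟨hodd₀, hdy₀, hred₀, hN₀, hdeg₀, hI₀⟩ :=
    redCuts_of_commuting_starred_twin hnf h5 u hu htw hpN hpN₀ hNN D D₀ hup hΔ hodd hdy hred hN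
  have hnd : ¬ (p : ℤ) ∣ D₀.maninConstant := hanchor W₀ D₀ hD₀ hpN₀ hodd₀ hdy₀ hred₀ hN₀ hdeg₀ hI₀ hΔ
  have hv₀ : padicValInt p D₀.c = 0 := padicValInt.eq_zero_of_not_dvd hnd
  have hc0 : D.c ≠ 0 := Int.cast_ne_zero.mp D.cast_c_ne_zero
  intro hpc
  have hpc' : (p : ℤ) ^ 1 ∣ D.c := by rw [pow_one]; exact hpc
  rcases (padicValInt_dvd_iff 1 D.c).mp hpc' with h | h
  · exact hc0 h
  · omega

/-! ## §2 `stub_red7ordIV` (v9) ⟸ ANCHOR(7; II*) ∧ E-imc-9(7) -/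

/-- **`stub_red7ordIV` (skeleton v9, VERBATIM) ⟸ ANCHOR(7; II*) (`hS`) ∧ E-imc-9 `OrdinaryRamifiedTwistLaw 7`
(`hO`).** ANCHOR(7; II*) := RED(57♯) (all cuts) for `W` of Kodaira type II* at `7` (`ord₇ Δ_min = 10`, tame
index `e = 6 = p − 1`: a starred Kummer corner, no method in print) ⟹ `7 ∤ c(D)`. The unstarred cell
`(7; IV)` (`e = 3 ∣ 6`, potentially ORDINARY — Edixhoven's case 1) rides its commuting II* twin by the cell
engine. With θ (p617914/p617000: II* ⟸ IV by transport) the two cells are ONE problem modulo E-imc-9(7).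
Census `N ≤ 5·10⁵`: 43 orbits IV → II*, all commuting, degree up, `c = 1`. Conditional result; closes nothing.
[cite: EdixhovenManin1991, Thm. 3 and §4] [cite: SerreTate1968, §2 Cor. 3] -/
theorem red7ordIV_of_anchorIIstarSeven_of_ordinaryRamifiedTwistLaw
    (hS : mazur_not_dvd_maninConstant_of_odd → abbesUllmo_not_dvd_maninConstant_of_not_dvd_level →
      cesnavicius_not_two_dvd_maninConstant_of_two_dvd_level → exists_isNewformOf →
      ∀ (W : WeierstrassCurve ℚ) [W.IsElliptic] [W.IsGloballyMinimal] [NeZero (W.conductorNorm ℤ)]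
        (D : ModularParametrizationData W (W.conductorNorm ℤ)),
        IsLatticeOptimal D → ∀ (p : ℕ) (hp : p.Prime), (p = 5 ∨ p = 7) → p ^ 2 ∣ W.conductorNorm ℤ →
        ¬ (∃ (W' : WeierstrassCurve ℚ) (q : ℕ), W'.IsElliptic ∧ W'.IsGloballyMinimal ∧ q.Prime ∧
            q ≠ 2 ∧ q ^ 2 ∣ W.conductorNorm ℤ ∧
            IsIsogenous W (W'.quadraticTwist (((-1 : ℤ) ^ (q / 2) * q : ℤ) : ℚ)) ∧
            ¬ q ^ 2 ∣ W'.conductorNorm ℤ) →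
        ¬ (∃ (W' : WeierstrassCurve ℚ) (d : ℤ), W'.IsElliptic ∧ W'.IsGloballyMinimal ∧
            (d = -1 ∨ d = 2 ∨ d = -2) ∧ 2 ^ 2 ∣ W.conductorNorm ℤ ∧
            IsIsogenous W (W'.quadraticTwist (d : ℚ)) ∧ ¬ 2 ^ 2 ∣ W'.conductorNorm ℤ) →
        ¬ W.HasIrreducibleModPGaloisRep p →
        500000 < W.conductorNorm ℤ →
        p ∣ D.modularDegree →
        (∀ n : ℕ, W.kodairaSymbolAt ((Rat.HeightOneSpectrum.primesEquiv (R := ℤ)).symm ⟨p, hp⟩) ≠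
          .Istar n) →
        p = 7 → padicValInt p W.minimalDiscriminantInt = 10 →
        ¬ (p : ℤ) ∣ D.maninConstant)
    (hO : OrdinaryRamifiedTwistLaw 7) :
    mazur_not_dvd_maninConstant_of_odd → abbesUllmo_not_dvd_maninConstant_of_not_dvd_level →
    cesnavicius_not_two_dvd_maninConstant_of_two_dvd_level → exists_isNewformOf →
    ∀ (W : WeierstrassCurve ℚ) [W.IsElliptic] [W.IsGloballyMinimal] [NeZero (W.conductorNorm ℤ)]
      (D : ModularParametrizationData W (W.conductorNorm ℤ)),
      IsLatticeOptimal D → ∀ (p : ℕ) (hp : p.Prime), (p = 5 ∨ p = 7) → p ^ 2 ∣ W.conductorNorm ℤ →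
      ¬ (∃ (W' : WeierstrassCurve ℚ) (q : ℕ), W'.IsElliptic ∧ W'.IsGloballyMinimal ∧ q.Prime ∧
          q ≠ 2 ∧ q ^ 2 ∣ W.conductorNorm ℤ ∧
          IsIsogenous W (W'.quadraticTwist (((-1 : ℤ) ^ (q / 2) * q : ℤ) : ℚ)) ∧
          ¬ q ^ 2 ∣ W'.conductorNorm ℤ) →
      ¬ (∃ (W' : WeierstrassCurve ℚ) (d : ℤ), W'.IsElliptic ∧ W'.IsGloballyMinimal ∧
          (d = -1 ∨ d = 2 ∨ d = -2) ∧ 2 ^ 2 ∣ W.conductorNorm ℤ ∧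
          IsIsogenous W (W'.quadraticTwist (d : ℚ)) ∧ ¬ 2 ^ 2 ∣ W'.conductorNorm ℤ) →
      ¬ W.HasIrreducibleModPGaloisRep p →
      500000 < W.conductorNorm ℤ →
      p ∣ D.modularDegree →
      (∀ n : ℕ, W.kodairaSymbolAt ((Rat.HeightOneSpectrum.primesEquiv (R := ℤ)).symm ⟨p, hp⟩) ≠
        .Istar n) →
      padicValInt p W.minimalDiscriminantInt ≤ 4 →
      (p = 5 → padicValInt p W.minimalDiscriminantInt ≠ 2) →
      p = 7 → padicValInt p W.minimalDiscriminantInt = 4 →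
      ¬ (p : ℤ) ∣ D.maninConstant := by
  intro hM hAU hC hnf W _ _ _ D hD p hp h57 hpN hodd hdy hred hN _hdeg _hI hv4 _h5II hp7 hv
  subst hp7
  have he : 12 / Nat.gcd 12 (padicValInt 7 W.minimalDiscriminantInt) ∣ 7 - 1 := by rw [hv]; decide
  exact not_dvd_maninConstant_of_starredTwinAnchor_of_ordinaryRamifiedTwistLaw hnf hp (by norm_num) hO W D hD
    hpN hodd hdy hred hN hv4 he
    (fun W₀ _ _ _ D₀ hD₀ hpN₀ hodd₀ hdy₀ hred₀ hN₀ hdeg₀ hI₀ hΔ ↦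
      hS hM hAU hC hnf W₀ D₀ hD₀ 7 hp h57 hpN₀ hodd₀ hdy₀ hred₀ hN₀ hdeg₀ hI₀ rfl (by omega))

/-! ## §3 `stub_red57corner` (v9) ⟸ ANCHOR(5; III*) ∧ ANCHOR(7; IV*) ∧ E-imc-9(5) ∧ E-imc-9(7) -/

/-- **`stub_red57corner` (skeleton v9, VERBATIM) ⟸ ANCHOR(5; III*) (`hS5`) ∧ ANCHOR(7; IV*) (`hS7`, the
hypothesis `hS` of the lead's ν `coreRED57unstarredOffII5_of_offII57_of_anchorIVstarSeven_of_degreeUpIISeven`,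
p624458, VERBATIM) ∧ E-imc-9 at `5` and `7`.** Both Kummer corners `(5; III)` (`e = 4 = p − 1`) and `(7; II)`
(`e = 6 = p − 1`) are potentially ORDINARY, so by the cell engine each rides its commuting starred twin:
`(5; III) → (5; III*)` (`ord₅ Δ_min = 9`, `e = 4`: again a corner — with θ the two are ONE problem modulo
E-imc-9(5); census 377 commuting orbits, degree up) and `(7; II) → (7; IV*)` (`ord₇ Δ_min = 8`, `e = 3 < p − 1`:
Raynaud-admissible, Edixhoven's Prop. 7 mechanism; census 112 commuting orbits). The `(7; II)` instance equals
ν fed with the degree law DEGREE-UP(7; II), which the width seat -w4 derives from E-imc-9(7) (piece ο); here it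
comes straight from the twin packet. Conditional result; closes nothing.
[cite: EdixhovenManin1991, Thm. 3, Prop. 7 and §4] [cite: KostersPannekoek2017, Thm. 1] -/
theorem red57corner_of_starredAnchors_of_ordinaryRamifiedTwistLaws
    (hS5 : mazur_not_dvd_maninConstant_of_odd → abbesUllmo_not_dvd_maninConstant_of_not_dvd_level →
      cesnavicius_not_two_dvd_maninConstant_of_two_dvd_level → exists_isNewformOf →
      ∀ (W : WeierstrassCurve ℚ) [W.IsElliptic] [W.IsGloballyMinimal] [NeZero (W.conductorNorm ℤ)]
        (D : ModularParametrizationData W (W.conductorNorm ℤ)),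
        IsLatticeOptimal D → ∀ (p : ℕ) (hp : p.Prime), (p = 5 ∨ p = 7) → p ^ 2 ∣ W.conductorNorm ℤ →
        ¬ (∃ (W' : WeierstrassCurve ℚ) (q : ℕ), W'.IsElliptic ∧ W'.IsGloballyMinimal ∧ q.Prime ∧
            q ≠ 2 ∧ q ^ 2 ∣ W.conductorNorm ℤ ∧
            IsIsogenous W (W'.quadraticTwist (((-1 : ℤ) ^ (q / 2) * q : ℤ) : ℚ)) ∧
            ¬ q ^ 2 ∣ W'.conductorNorm ℤ) →
        ¬ (∃ (W' : WeierstrassCurve ℚ) (d : ℤ), W'.IsElliptic ∧ W'.IsGloballyMinimal ∧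
            (d = -1 ∨ d = 2 ∨ d = -2) ∧ 2 ^ 2 ∣ W.conductorNorm ℤ ∧
            IsIsogenous W (W'.quadraticTwist (d : ℚ)) ∧ ¬ 2 ^ 2 ∣ W'.conductorNorm ℤ) →
        ¬ W.HasIrreducibleModPGaloisRep p →
        500000 < W.conductorNorm ℤ →
        p ∣ D.modularDegree →
        (∀ n : ℕ, W.kodairaSymbolAt ((Rat.HeightOneSpectrum.primesEquiv (R := ℤ)).symm ⟨p, hp⟩) ≠
          .Istar n) →
        p = 5 → padicValInt p W.minimalDiscriminantInt = 9 →
        ¬ (p : ℤ) ∣ D.maninConstant)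
    (hS7 : mazur_not_dvd_maninConstant_of_odd → abbesUllmo_not_dvd_maninConstant_of_not_dvd_level →
      cesnavicius_not_two_dvd_maninConstant_of_two_dvd_level → exists_isNewformOf →
      ∀ (W : WeierstrassCurve ℚ) [W.IsElliptic] [W.IsGloballyMinimal] [NeZero (W.conductorNorm ℤ)]
        (D : ModularParametrizationData W (W.conductorNorm ℤ)),
        IsLatticeOptimal D → ∀ (p : ℕ) (hp : p.Prime), (p = 5 ∨ p = 7) → p ^ 2 ∣ W.conductorNorm ℤ →
        ¬ (∃ (W' : WeierstrassCurve ℚ) (q : ℕ), W'.IsElliptic ∧ W'.IsGloballyMinimal ∧ q.Prime ∧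
            q ≠ 2 ∧ q ^ 2 ∣ W.conductorNorm ℤ ∧
            IsIsogenous W (W'.quadraticTwist (((-1 : ℤ) ^ (q / 2) * q : ℤ) : ℚ)) ∧
            ¬ q ^ 2 ∣ W'.conductorNorm ℤ) →
        ¬ (∃ (W' : WeierstrassCurve ℚ) (d : ℤ), W'.IsElliptic ∧ W'.IsGloballyMinimal ∧
            (d = -1 ∨ d = 2 ∨ d = -2) ∧ 2 ^ 2 ∣ W.conductorNorm ℤ ∧
            IsIsogenous W (W'.quadraticTwist (d : ℚ)) ∧ ¬ 2 ^ 2 ∣ W'.conductorNorm ℤ) →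
        ¬ W.HasIrreducibleModPGaloisRep p →
        500000 < W.conductorNorm ℤ →
        p ∣ D.modularDegree →
        (∀ n : ℕ, W.kodairaSymbolAt ((Rat.HeightOneSpectrum.primesEquiv (R := ℤ)).symm ⟨p, hp⟩) ≠
          .Istar n) →
        p = 7 → padicValInt p W.minimalDiscriminantInt = 8 →
        ¬ (p : ℤ) ∣ D.maninConstant)
    (hO5 : OrdinaryRamifiedTwistLaw 5) (hO7 : OrdinaryRamifiedTwistLaw 7) :
    mazur_not_dvd_maninConstant_of_odd → abbesUllmo_not_dvd_maninConstant_of_not_dvd_level →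
    cesnavicius_not_two_dvd_maninConstant_of_two_dvd_level → exists_isNewformOf →
    ∀ (W : WeierstrassCurve ℚ) [W.IsElliptic] [W.IsGloballyMinimal] [NeZero (W.conductorNorm ℤ)]
      (D : ModularParametrizationData W (W.conductorNorm ℤ)),
      IsLatticeOptimal D → ∀ (p : ℕ) (hp : p.Prime), (p = 5 ∨ p = 7) → p ^ 2 ∣ W.conductorNorm ℤ →
      ¬ (∃ (W' : WeierstrassCurve ℚ) (q : ℕ), W'.IsElliptic ∧ W'.IsGloballyMinimal ∧ q.Prime ∧
          q ≠ 2 ∧ q ^ 2 ∣ W.conductorNorm ℤ ∧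
          IsIsogenous W (W'.quadraticTwist (((-1 : ℤ) ^ (q / 2) * q : ℤ) : ℚ)) ∧
          ¬ q ^ 2 ∣ W'.conductorNorm ℤ) →
      ¬ (∃ (W' : WeierstrassCurve ℚ) (d : ℤ), W'.IsElliptic ∧ W'.IsGloballyMinimal ∧
          (d = -1 ∨ d = 2 ∨ d = -2) ∧ 2 ^ 2 ∣ W.conductorNorm ℤ ∧
          IsIsogenous W (W'.quadraticTwist (d : ℚ)) ∧ ¬ 2 ^ 2 ∣ W'.conductorNorm ℤ) →
      ¬ W.HasIrreducibleModPGaloisRep p →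
      500000 < W.conductorNorm ℤ →
      p ∣ D.modularDegree →
      (∀ n : ℕ, W.kodairaSymbolAt ((Rat.HeightOneSpectrum.primesEquiv (R := ℤ)).symm ⟨p, hp⟩) ≠
        .Istar n) →
      padicValInt p W.minimalDiscriminantInt ≤ 4 →
      (p = 5 → padicValInt p W.minimalDiscriminantInt ≠ 2) →
      ((p = 5 ∧ padicValInt p W.minimalDiscriminantInt = 3) ∨
        (p = 7 ∧ padicValInt p W.minimalDiscriminantInt = 2)) →
      ¬ (p : ℤ) ∣ D.maninConstant := by
  intro hM hAU hC hnf W _ _ _ D hD p hp h57 hpN hodd hdy hred hN _hdeg _hI hv4 _h5II hcell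
  rcases hcell with ⟨hp5, hv⟩ | ⟨hp7, hv⟩
  · subst hp5
    have he : 12 / Nat.gcd 12 (padicValInt 5 W.minimalDiscriminantInt) ∣ 5 - 1 := by rw [hv]; decide
    exact not_dvd_maninConstant_of_starredTwinAnchor_of_ordinaryRamifiedTwistLaw hnf hp le_rfl hO5 W D hD
      hpN hodd hdy hred hN hv4 he
      (fun W₀ _ _ _ D₀ hD₀ hpN₀ hodd₀ hdy₀ hred₀ hN₀ hdeg₀ hI₀ hΔ ↦
        hS5 hM hAU hC hnf W₀ D₀ hD₀ 5 hp h57 hpN₀ hodd₀ hdy₀ hred₀ hN₀ hdeg₀ hI₀ rfl (by omega))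
  · subst hp7
    have he : 12 / Nat.gcd 12 (padicValInt 7 W.minimalDiscriminantInt) ∣ 7 - 1 := by rw [hv]; decide
    exact not_dvd_maninConstant_of_starredTwinAnchor_of_ordinaryRamifiedTwistLaw hnf hp (by norm_num) hO7 W D hD
      hpN hodd hdy hred hN hv4 he
      (fun W₀ _ _ _ D₀ hD₀ hpN₀ hodd₀ hdy₀ hred₀ hN₀ hdeg₀ hI₀ hΔ ↦
        hS7 hM hAU hC hnf W₀ D₀ hD₀ 7 hp h57 hpN₀ hodd₀ hdy₀ hred₀ hN₀ hdeg₀ hI₀ rfl (by omega))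

/-! ## §4 By-name ledger: the v8 anchor stub ⟸ SS57 ∧ ANCHOR-ORD★(57) ∧ E-imc-9(5) ∧ E-imc-9(7) -/

/-- **The v8 anchor `stub_red57unstarredOffIIAtFive` (VERBATIM as the conclusion) ⟸ SS57 (`hSS`, the v9 stub
`stub_red57ss` verbatim) ∧ ANCHOR-ORD★(57) (`hStar`) ∧ E-imc-9 at `5` and `7`**, where ANCHOR-ORD★(57) := Manin's
`p ∤ c(D)` under the RED(57♯) cuts for the three STARRED potentially-ORDINARY cells `(5; III*)`, `(7; IV*)`,
`(7; II*)` (`(p; ord_p Δ_min) ∈ {(5;9), (7;8), (7;10)}`; census: these are exactly the starred ends of the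
377 + 112 + 43 commuting orbits). The lead's Ogg–Tate reassembly `coreRED57unstarredOffII5_of_cells` (p625709)
fed with §2 and §3. NET READING of the `W[p]`-reducible residue of C5 at `p ∈ {5, 7}` after this file: modulo
the imc cell's E-imc-5 / E-imc-9, it is SS57 (the potentially supersingular unstarred cells, which FLIP) plus
ONE Manin statement per potentially-ordinary commuting orbit, readable on either end (θ: starred ⟸ unstarred;
this file: unstarred ⟸ starred). Conditional result; closes nothing; C5 is not proved.
[cite: EdixhovenManin1991, Thm. 3, Prop. 7 and §4] [cite: SilvermanATAEC1994, IV Table 4.1] -/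
theorem red57unstarredOffIIAtFive_of_ss_of_starredOrdAnchor_of_ordinaryRamifiedTwistLaws
    (hSS : mazur_not_dvd_maninConstant_of_odd → abbesUllmo_not_dvd_maninConstant_of_not_dvd_level →
      cesnavicius_not_two_dvd_maninConstant_of_two_dvd_level → exists_isNewformOf →
      ∀ (W : WeierstrassCurve ℚ) [W.IsElliptic] [W.IsGloballyMinimal] [NeZero (W.conductorNorm ℤ)]
        (D : ModularParametrizationData W (W.conductorNorm ℤ)),
        IsLatticeOptimal D → ∀ (p : ℕ) (hp : p.Prime), (p = 5 ∨ p = 7) → p ^ 2 ∣ W.conductorNorm ℤ →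
        ¬ (∃ (W' : WeierstrassCurve ℚ) (q : ℕ), W'.IsElliptic ∧ W'.IsGloballyMinimal ∧ q.Prime ∧
            q ≠ 2 ∧ q ^ 2 ∣ W.conductorNorm ℤ ∧
            IsIsogenous W (W'.quadraticTwist (((-1 : ℤ) ^ (q / 2) * q : ℤ) : ℚ)) ∧
            ¬ q ^ 2 ∣ W'.conductorNorm ℤ) →
        ¬ (∃ (W' : WeierstrassCurve ℚ) (d : ℤ), W'.IsElliptic ∧ W'.IsGloballyMinimal ∧
            (d = -1 ∨ d = 2 ∨ d = -2) ∧ 2 ^ 2 ∣ W.conductorNorm ℤ ∧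
            IsIsogenous W (W'.quadraticTwist (d : ℚ)) ∧ ¬ 2 ^ 2 ∣ W'.conductorNorm ℤ) →
        ¬ W.HasIrreducibleModPGaloisRep p →
        500000 < W.conductorNorm ℤ →
        p ∣ D.modularDegree →
        (∀ n : ℕ, W.kodairaSymbolAt ((Rat.HeightOneSpectrum.primesEquiv (R := ℤ)).symm ⟨p, hp⟩) ≠
          .Istar n) →
        padicValInt p W.minimalDiscriminantInt ≤ 4 →
        (p = 5 → padicValInt p W.minimalDiscriminantInt ≠ 2) →
        ((p = 5 ∧ padicValInt p W.minimalDiscriminantInt = 4) ∨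
          (p = 7 ∧ padicValInt p W.minimalDiscriminantInt = 3)) →
        ¬ (p : ℤ) ∣ D.maninConstant)
    (hStar : mazur_not_dvd_maninConstant_of_odd → abbesUllmo_not_dvd_maninConstant_of_not_dvd_level →
      cesnavicius_not_two_dvd_maninConstant_of_two_dvd_level → exists_isNewformOf →
      ∀ (W : WeierstrassCurve ℚ) [W.IsElliptic] [W.IsGloballyMinimal] [NeZero (W.conductorNorm ℤ)]
        (D : ModularParametrizationData W (W.conductorNorm ℤ)),
        IsLatticeOptimal D → ∀ (p : ℕ) (hp : p.Prime), (p = 5 ∨ p = 7) → p ^ 2 ∣ W.conductorNorm ℤ →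
        ¬ (∃ (W' : WeierstrassCurve ℚ) (q : ℕ), W'.IsElliptic ∧ W'.IsGloballyMinimal ∧ q.Prime ∧
            q ≠ 2 ∧ q ^ 2 ∣ W.conductorNorm ℤ ∧
            IsIsogenous W (W'.quadraticTwist (((-1 : ℤ) ^ (q / 2) * q : ℤ) : ℚ)) ∧
            ¬ q ^ 2 ∣ W'.conductorNorm ℤ) →
        ¬ (∃ (W' : WeierstrassCurve ℚ) (d : ℤ), W'.IsElliptic ∧ W'.IsGloballyMinimal ∧
            (d = -1 ∨ d = 2 ∨ d = -2) ∧ 2 ^ 2 ∣ W.conductorNorm ℤ ∧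
            IsIsogenous W (W'.quadraticTwist (d : ℚ)) ∧ ¬ 2 ^ 2 ∣ W'.conductorNorm ℤ) →
        ¬ W.HasIrreducibleModPGaloisRep p →
        500000 < W.conductorNorm ℤ →
        p ∣ D.modularDegree →
        (∀ n : ℕ, W.kodairaSymbolAt ((Rat.HeightOneSpectrum.primesEquiv (R := ℤ)).symm ⟨p, hp⟩) ≠
          .Istar n) →
        ((p = 5 ∧ padicValInt p W.minimalDiscriminantInt = 9) ∨
          (p = 7 ∧ padicValInt p W.minimalDiscriminantInt = 8) ∨
          (p = 7 ∧ padicValInt p W.minimalDiscriminantInt = 10)) →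
        ¬ (p : ℤ) ∣ D.maninConstant)
    (hO5 : OrdinaryRamifiedTwistLaw 5) (hO7 : OrdinaryRamifiedTwistLaw 7) :
    mazur_not_dvd_maninConstant_of_odd → abbesUllmo_not_dvd_maninConstant_of_not_dvd_level →
    cesnavicius_not_two_dvd_maninConstant_of_two_dvd_level → exists_isNewformOf →
    ∀ (W : WeierstrassCurve ℚ) [W.IsElliptic] [W.IsGloballyMinimal] [NeZero (W.conductorNorm ℤ)]
      (D : ModularParametrizationData W (W.conductorNorm ℤ)),
      IsLatticeOptimal D → ∀ (p : ℕ) (hp : p.Prime), (p = 5 ∨ p = 7) → p ^ 2 ∣ W.conductorNorm ℤ →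
      ¬ (∃ (W' : WeierstrassCurve ℚ) (q : ℕ), W'.IsElliptic ∧ W'.IsGloballyMinimal ∧ q.Prime ∧
          q ≠ 2 ∧ q ^ 2 ∣ W.conductorNorm ℤ ∧
          IsIsogenous W (W'.quadraticTwist (((-1 : ℤ) ^ (q / 2) * q : ℤ) : ℚ)) ∧
          ¬ q ^ 2 ∣ W'.conductorNorm ℤ) →
      ¬ (∃ (W' : WeierstrassCurve ℚ) (d : ℤ), W'.IsElliptic ∧ W'.IsGloballyMinimal ∧
          (d = -1 ∨ d = 2 ∨ d = -2) ∧ 2 ^ 2 ∣ W.conductorNorm ℤ ∧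
          IsIsogenous W (W'.quadraticTwist (d : ℚ)) ∧ ¬ 2 ^ 2 ∣ W'.conductorNorm ℤ) →
      ¬ W.HasIrreducibleModPGaloisRep p →
      500000 < W.conductorNorm ℤ →
      p ∣ D.modularDegree →
      (∀ n : ℕ, W.kodairaSymbolAt ((Rat.HeightOneSpectrum.primesEquiv (R := ℤ)).symm ⟨p, hp⟩) ≠
        .Istar n) →
      padicValInt p W.minimalDiscriminantInt ≤ 4 →
      (p = 5 → padicValInt p W.minimalDiscriminantInt ≠ 2) →
      ¬ (p : ℤ) ∣ D.maninConstant :=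
  coreRED57unstarredOffII5_of_cells hSS
    (red7ordIV_of_anchorIIstarSeven_of_ordinaryRamifiedTwistLaw
      (fun hM hAU hC hnf W _ _ _ D hD p hp h57 hpN hodd hdy hred hN hdeg hI hp7 hv ↦
        hStar hM hAU hC hnf W D hD p hp h57 hpN hodd hdy hred hN hdeg hI (Or.inr (Or.inr ⟨hp7, hv⟩))) hO7)
    (red57corner_of_starredAnchors_of_ordinaryRamifiedTwistLaws
      (fun hM hAU hC hnf W _ _ _ D hD p hp h57 hpN hodd hdy hred hN hdeg hI hp5 hv ↦
        hStar hM hAU hC hnf W D hD p hp h57 hpN hodd hdy hred hN hdeg hI (Or.inl ⟨hp5, hv⟩))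
      (fun hM hAU hC hnf W _ _ _ D hD p hp h57 hpN hodd hdy hred hN hdeg hI hp7 hv ↦
        hStar hM hAU hC hnf W D hD p hp h57 hpN hodd hdy hred hN hdeg hI (Or.inr (Or.inl ⟨hp7, hv⟩))) hO5 hO7)

end Summit.BirchSwinnertonDyer.BirchSwinnertonDyer.Theorems

end
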